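import Literature.AlgebraicGeometry.HodgeTheory.AbelianVarietyUniformisationPicard
import Literature.Geometry.Kaehler.ComplexTorusPicardTranslation
import HarnessLib

/-!
# `[L₁] = [L₂]` in Lange's `Pic(X)` iff the rank-one cocycles are holomorphically isomorphic (converse junction)

Layer `Literature/AlgebraicGeometry/HodgeTheory`, namespace `Literature.AlgebraicGeometry.HodgeTheory`. Sequel (kept
separate for the 400-line rule) of `HodgeTheory/AbelianVarietyUniformisationPicard` (§1 there:
`picClass_eq_of_analyticallyEquivalent`, analytically equivalent cocycles ⇒ equal classes). Here the CONVERSE: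
* `analyticallyEquivalent_of_picClass_eq` — two holomorphic line bundles on a complex torus `X = V/Λ` (arbitrary
  trivialising covers) with the same class `φ₁⁻¹(L₁) = φ₁⁻¹(L₂) ∈ Pic(X) = H¹(Λ, H⁰(𝒪_V^*))` have analytically
  equivalent rank-one cocycles in the sense of Fritzsche–Grauert IV §2 (C) (`SmoothComplexVectorBundle.AnalyticallyEquivalent`
  of their `toSmoothCocycle`s): by Lange §1.2.1 Prop. 1.2.2–1.2.3 (`picClass_eq_picClass_iff`) there is a common factor
  `f` with `L₁ ⊗ L_{f⁻¹}` and `L₂ ⊗ L_{f⁻¹}` holomorphically trivial, trivialised by `s`, `s'`; the units are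
  `μ_{a i} := s'_{(a,p)} / s_{(i,p)}` (independent of the chart `p` of `L_{f⁻¹}`);
* `picClass_eq_iff_analyticallyEquivalent` — the two directions together.
Purpose (cell `hodgecm-mathlib`, rung 0 on `hDel`, road (R1a)): results PROVED in the GAGA cocycle currency — notably
GAGA injectivity on `Pic` («analytically equivalent `𝒪(D)^an`, `𝒪(E)^an` ⇒ `D ∼ E`», cell row B1) — become
applicable to classes computed in `Pic(X)` (`picClass_cartierDivisorLineBundle_mem_picZero`, `…_weilDiv`).
Theorems only; no `def`, no named fact, no instance.

## References
* H. Lange, *Abelian Varieties over the Complex Numbers* (2023), §1.2.1 Prop. 1.2.2–1.2.3 (p. 21).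
  [Lange2023AbelianVarietiesComplex]
* K. Fritzsche, H. Grauert, *From Holomorphic Functions to Complex Manifolds*, GTM 213 (2002), Ch. IV §2 (C).
  [FritzscheGrauert2002]
-/

noncomputable section

open Set Function
open scoped Manifold ContDiff Topology
open Literature.AlgebraicGeometry.Motives Literature.Geometry.Kaehler Literature.Geometry.Kaehler.ComplexTorus
open Literature.NumberTheory.Transcendental

namespace Literature.AlgebraicGeometry.HodgeTheory

section Converse

variable {ι : Type*} {E : Type*} [NormedAddCommGroup E] [NormedSpace ℂ E] {Φ : (ι → ℝ) ≃L[ℝ] E}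
  [Fintype ι] [FiniteDimensional ℂ E] {κ₁ κ₂ : Type*}

/-- **Line bundles with the same class in `Pic(X)` have holomorphically isomorphic cocycles** (the converse of
`picClass_eq_of_analyticallyEquivalent`): a common factor `f` with `L₁ ⊗ L_{f⁻¹}` and `L₂ ⊗ L_{f⁻¹}` trivial
(`picClass_eq_picClass_iff`, Lange §1.2.1 Prop. 1.2.2–1.2.3), trivialised by `s`, `s'`, gives the units
`μ_{a i} := s'_{(a,p)} / s_{(i,p)}` on `U¹_i ∩ U²_a` (independent of the chart `p` of `L_{f⁻¹}`), which satisfy condition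
(C) of Fritzsche–Grauert IV §2. [cite: Lange2023AbelianVarietiesComplex, §1.2.1 Prop. 1.2.2–1.2.3, p. 21]
[cite: FritzscheGrauert2002, Ch. IV §2 (C)] -/
theorem analyticallyEquivalent_of_picClass_eq
    [IsManifold 𝓘(ℂ, E) ω (ComplexTorus Φ)] [IsManifold 𝓘(ℝ, E) ∞ (ComplexTorus Φ)]
    {L₁ : HolomorphicLineBundle κ₁ E (ComplexTorus Φ)} {L₂ : HolomorphicLineBundle κ₂ E (ComplexTorus Φ)}
    (h : picClass L₁ = picClass L₂) :
    SmoothComplexVectorBundle.AnalyticallyEquivalent L₁.toSmoothCocycle L₂.toSmoothCocycle := by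
  classical
  obtain ⟨f, h₁, h₂⟩ := (picClass_eq_picClass_iff L₁ L₂).1 h
  set F := f⁻¹.lineBundle with hF
  obtain ⟨s, hs, hs0, hsg⟩ := h₁
  obtain ⟨s', hs', hs0', hsg'⟩ := h₂
  choose px hpx using F.exists_mem_baseSet
  -- the candidate units and their independence of the chart `p` of `L_{f⁻¹}`
  set μ : κ₂ → κ₁ → ComplexTorus Φ → ℂ := fun a i x ↦ s' (a, px x) x / s (i, px x) x with hμ
  have hind : ∀ (a : κ₂) (i : κ₁) (p q : ι → ℝ) (x : ComplexTorus Φ), x ∈ L₁.baseSet i → x ∈ L₂.baseSet a →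
      x ∈ F.baseSet p → x ∈ F.baseSet q → s' (a, p) x / s (i, p) x = s' (a, q) x / s (i, q) x := by
    intro a i p q x hi ha hp hq
    have e1 := hsg (i, p) (i, q) x ⟨⟨⟨hi, hp⟩, hi, hq⟩, mem_univ x⟩
    have e2 := hsg' (a, p) (a, q) x ⟨⟨⟨ha, hp⟩, ha, hq⟩, mem_univ x⟩
    rw [HolomorphicLineBundle.tensor_coordChange_apply, L₁.coordChange_self i hi, one_mul] at e1
    rw [HolomorphicLineBundle.tensor_coordChange_apply, L₂.coordChange_self a ha, one_mul] at e2
    have hc : F.coordChange p q x ≠ 0 := F.coordChange_ne_zero p q x ⟨hp, hq⟩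
    have hsip : s (i, p) x ≠ 0 := hs0 (i, p) x ⟨⟨hi, hp⟩, mem_univ x⟩
    rw [e1, e2]
    field_simp
  refine ⟨⟨fun a i x ↦ Matrix.of fun _ _ ↦ μ a i x, fun a i x hx ↦ ?_, fun a b i j x hx ↦ ?_⟩, fun a i p q ↦ ?_⟩
  · -- units
    rw [Matrix.isUnit_iff_isUnit_det, Matrix.det_unique, Matrix.of_apply, isUnit_iff_ne_zero, hμ]
    exact div_ne_zero (hs0' (a, px x) x ⟨⟨hx.2, hpx x⟩, mem_univ x⟩) (hs0 (i, px x) x ⟨⟨hx.1, hpx x⟩, mem_univ x⟩)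
  · -- condition (C): `μ_{a i} g¹_{j i} = g²_{b a} μ_{b j}`
    obtain ⟨⟨hi, hj⟩, ha, hb⟩ := hx
    ext r r'
    simp only [Matrix.mul_apply, Fin.sum_univ_one, Matrix.of_apply,
      HolomorphicLineBundle.toSmoothCocycle_coordChange_apply, hμ]
    set p := px x
    have e1 := hsg (i, p) (j, p) x ⟨⟨⟨hi, hpx x⟩, hj, hpx x⟩, mem_univ x⟩
    have e2 := hsg' (a, p) (b, p) x ⟨⟨⟨ha, hpx x⟩, hb, hpx x⟩, mem_univ x⟩
    rw [HolomorphicLineBundle.tensor_coordChange_apply, F.coordChange_self p (hpx x), mul_one] at e1 e2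
    have hsip : s (i, p) x ≠ 0 := hs0 (i, p) x ⟨⟨hi, hpx x⟩, mem_univ x⟩
    have hg1 : L₁.coordChange i j x ≠ 0 := L₁.coordChange_ne_zero i j x ⟨hi, hj⟩
    have hg2 : L₂.coordChange a b x ≠ 0 := L₂.coordChange_ne_zero a b x ⟨ha, hb⟩
    have hji : L₁.coordChange j i x = (L₁.coordChange i j x)⁻¹ :=
      eq_inv_of_mul_eq_one_left (L₁.coordChange_mul_symm j i hj hi)
    have hba : L₂.coordChange b a x = (L₂.coordChange a b x)⁻¹ :=
      eq_inv_of_mul_eq_one_left (L₂.coordChange_mul_symm b a hb ha)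
    rw [e1, e2, hji, hba]
    field_simp
  · -- holomorphy: locally `μ_{a i} = s'_{(a,p₀)} / s_{(i,p₀)}` for a fixed chart `p₀`
    intro x₀ hx₀
    obtain ⟨hi, ha⟩ := hx₀
    set p₀ := px x₀ with hp₀
    have hO : F.baseSet p₀ ∈ 𝓝 x₀ := (F.isOpen_baseSet p₀).mem_nhds (hpx x₀)
    have hg : MDifferentiableOn 𝓘(ℂ, E) 𝓘(ℂ, ℂ) (fun x ↦ s' (a, p₀) x / s (i, p₀) x)
        ((L₁.baseSet i ∩ L₂.baseSet a) ∩ F.baseSet p₀) :=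
      ((hs' (a, p₀)).mono fun x hx ↦ ⟨⟨hx.1.2, hx.2⟩, mem_univ x⟩).div
        ((hs (i, p₀)).mono fun x hx ↦ ⟨⟨hx.1.1, hx.2⟩, mem_univ x⟩)
        fun x hx ↦ hs0 (i, p₀) x ⟨⟨hx.1.1, hx.2⟩, mem_univ x⟩
    have hgx := (mdifferentiableWithinAt_inter hO).1 (hg x₀ ⟨⟨hi, ha⟩, hpx x₀⟩)
    refine hgx.congr_of_eventuallyEq ?_ ?_
    · filter_upwards [self_mem_nhdsWithin, mem_nhdsWithin_of_mem_nhds hO] with x hx hxp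
      simp only [Matrix.of_apply, hμ]
      exact hind a i (px x) p₀ x hx.1 hx.2 (hpx x) hxp
    · simp only [Matrix.of_apply, hμ, hp₀]

/-- **`[L₁] = [L₂]` in `Pic(X)` iff the rank-one cocycles are holomorphically isomorphic.**
[cite: Lange2023AbelianVarietiesComplex, §1.2.1 Prop. 1.2.2–1.2.3, p. 21] [cite: FritzscheGrauert2002, Ch. IV §2 (C)] -/
theorem picClass_eq_iff_analyticallyEquivalent
    [IsManifold 𝓘(ℂ, E) ω (ComplexTorus Φ)] [IsManifold 𝓘(ℝ, E) ∞ (ComplexTorus Φ)]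
    (L₁ : HolomorphicLineBundle κ₁ E (ComplexTorus Φ)) (L₂ : HolomorphicLineBundle κ₂ E (ComplexTorus Φ)) :
    picClass L₁ = picClass L₂ ↔
      SmoothComplexVectorBundle.AnalyticallyEquivalent L₁.toSmoothCocycle L₂.toSmoothCocycle :=
  ⟨analyticallyEquivalent_of_picClass_eq, picClass_eq_of_analyticallyEquivalent⟩

end Converse

end Literature.AlgebraicGeometry.HodgeTheory

end
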